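import Summits.BirchSwinnertonDyer.Rank1Residual.X11b.InterpolationCharacterSupply
import HarnessLib

set_option linter.dupNamespace false
set_option autoImplicit false

/-!
# Route `CongruentShaFreeCut` (rung S2) — crux `AnalyticRankOneOfRankOneFiniteShaTwo`
(stmt-BirchSwinnertonDyer-19080), line `two-adic-bdp-triple` (v5b): the anticyclotomic λ-SUPPLY of
SOME positive infinity type `(m, −m)` AT EVERY PRIME `p` — the `p ≠ 2` hypothesis of the tree's
`X11b.lambdaSupplyAt` / `X11b.LambdaSupply.exists_lambda_of_character` REMOVED (file 1 of 2 of the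
`p = 2` character-supply port; file 2 = `Theorems/CongruentShaFreeCutCharacterSupply.lean`)

Cell `bsd-cn100`, prover seat `bsd-cn100-transfer` (g8), executing the plan seat's PORT NOTE
(`HOME/bsd-cn100-plan/routes-g11/kit/P2-CHARACTER-SUPPLY-PORT-NOTE.md`, 2026-08-26T10:3xZ). Supports,
does not close, stmt-BirchSwinnertonDyer-19080. HONEST FRAMING: nothing here proves crux B, Link B,
the three BDP-currency statements (LB-exist)/(LB-wan)/(LB-bdp) of
`Theorems/CongruentShaFreeCutTwoAdicBDPTriple.lean`, the leaf `rankOne_twoConverse_congruentNumber`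
or any case of BSD. It is a SUPPORT LEMMA (class field theory bookkeeping on the tree's Hecke
characters): the input from which file 2 derives, at `p = 2`, the interpolation-character supply and
the RIGIDITY of the BDP frame `IsBDPLFunction ι' v κ γ f Ω_K Ω_p ·` quantified over in (LB-wan)/(LB-bdp).

## The one `p ≠ 2` step of the X11b chain, and how it is bypassed (all `p`)

The odd-`p` λ-supply `X11b.LambdaSupply.exists_lambda_of_character` builds, from ONE algebraic Hecke
character `Ψ` of the imaginary quadratic `K` unramified outside `p` with `Ψ·(Ψ∘c)⁻¹` unitary of
infinity type `(1,−1)`, the anticyclotomic character `λ := Ψ′·(Ψ′∘c)⁻¹` of type EXACTLY `(1,−1)`,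
`Ψ′ = Ψ·μ_ω·μ_φ′` a finite-order twist; `p ≠ 2` enters twice (PORT NOTE (O1)/(O2)): the halving
exponent `(p^s+1)/2` of the twist `φ′` (`LambdaSupply.PadicUnits.exists_twists`) and "principal units
have no `2`-torsion" (`PadicUnits.eq_one_of_mul_self_eq_one`) in LEMMA Λ′ ⇒ `FactorsThroughZp`.
Every CONSUMER below the λ-supply, however, only needs SOME positive infinity type `(m, −m)`
(`LambdaSupply.exists_interpolationCharacter` already returns `∃ m > 0`). For such a λ NO twist is
needed at all: with `a` Weil's `p`-adic character of `Ψ` (values in a finite `E/ℚ_p`), `θ` the lift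
of complex conjugation to `Γ_K` and `h := a·(a∘θ)⁻¹`,
* `h^M = 1` on `N = Gal(K̄/K̃_∞)` for some `M ≥ 1` — "a `p`-adic character has finite order on
  `Gal(K̄/K̃_∞)`" (x11b3's log-coordinates lemma `PadicUnits.pow_eq_one_of_forall_character`, every
  `p`, no principal-unit hypothesis);
* `h^M` is anti-invariant (`h(θσ) = h(σ)⁻¹`) and kills `N`, so by x11b3's LEMMA Λ′
  `mul_self_eq_one_of_anti` (every `p`) `h^M(σ)² = 1` for every `σ ∈ ker κ`, i.e. **`h^{2M}` KILLS
  `ker κ`** — the squaring replaces "no `2`-torsion among principal units";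
* hence `λ := Ψ^{2M}·(Ψ^{2M}∘c)⁻¹` is unitary of infinity type `(2M, −2M)`, trivial on `𝕀_ℚ`,
  unramified outside `p`, with `p`-adic avatar `e∘(ψ^{2M}·(ψ^{2M}∘θ)⁻¹)`, `ψ = ι_E∘a⁻¹`, which
  FACTORS THROUGH `κ` (`exists_lambda_pow_of_character`; `lambdaSupplyPowAt` = the supply statement
  "`∃ m > 0`, type `(m,−m)`" for every imaginary quadratic `K`, anticyclotomic `κ`, `ι' : ℚ̄_p ≃ ℂ`).

PROVENANCE / CREDIT: Steps 1–2 of `exists_lambda_pow_of_character` (the involution `c`, its lift `θ`,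
the rank-two basis `Φ₀, Φ₁`, Weil's character and its rank-one currency) are COPIED from team x11b3 /
sub-cell multr1-p2's `X11b.LambdaSupply.exists_lambda_of_character` (`X11b/LambdaSupplyPrime.lean`;
ingredients `X11b/Three/LambdaSupply*.lean`, seats `b2b-bsdres-x11b3-p2/p3/p7`), whose lemmas are
IMPORTED, not restated; the only new mathematics is the squaring step (Steps 3–4). Nothing of theirs is
touched or renamed; at odd `p` their `m = 1` statement is sharper and stays the one of record.

## References

* [Greenberg1987] R. Greenberg, *Non-vanishing of certain values of `L`-functions*, Progr. Math. 70
  (1987), §2 (anticyclotomic characters as quotients `Ψ/Ψ∘c`; `p`-general up to torsion bookkeeping).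
* [Weil1956] A. Weil, *On a certain type of characters of the idèle-class group*, §1–§2.
* [Washington1997] L. C. Washington, *Introduction to Cyclotomic Fields*, §5.1, §13.1, Thm. 13.4.
-/

noncomputable section

open scoped NumberField Classical Topology
open NumberField IsDedekindDomain Field Filter Topology Polynomial
  Literature.NumberTheory.GaloisRepresentations Literature.NumberTheory.EllipticCurves
  Literature.NumberTheory.Automorphic

namespace Summit.BirchSwinnertonDyer.BirchSwinnertonDyer.Theorems.CongruentShaFreeCutLambdaSupplyAllPrimes

open Summit.BirchSwinnertonDyer.Rank1Residual.X11b.Three.LambdaSupply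
open Summit.BirchSwinnertonDyer.Rank1Residual.X11b.Three.LambdaSupply.PadicUnits
open Summit.BirchSwinnertonDyer.Rank1Residual.X11b.LambdaSupply
open Summit.BirchSwinnertonDyer.Rank1Residual.X11b

section Core

variable {K : Type} [Field K] [NumberField K] {p : ℕ} [Fact p.Prime]

/-- **The anticyclotomic pair `(λ, r_λ)` of infinity type `(m, −m)`, `m > 0`, from one algebraic
Hecke character `Ψ`, at EVERY prime `p`.** `K` imaginary quadratic (`[K:ℚ] = 2`, all infinite
places complex), `κ : Γ_K ↠ ℤ_p` anticyclotomic, `ι : ℚ̄_p ≃ ℂ`, `σ_c ≠ 1`, `Ψ` algebraic and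
unramified outside `p` with `Ψ·(Ψ∘σ_c)⁻¹` unitary of type `(1,−1)`. Then for some `m > 0` there is a
pair `(λ, r_λ)`: `λ` unitary of infinity type `(m,−m)`, trivial on `𝕀_ℚ`, unramified outside `p`,
`r_λ` its `p`-adic avatar, `r_λ` FACTORING THROUGH `κ`. Construction: `λ := Ψ^{2M}·(Ψ^{2M}∘σ_c)⁻¹`
where `h^M = 1` on `Gal(K̄/K̃_∞)` for `h = a·(a∘θ)⁻¹`, `a` Weil's character of `Ψ`
(`pow_eq_one_of_forall_character`); `h^{2M}` kills `ker κ` by LEMMA Λ′ (`mul_self_eq_one_of_anti`).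
No finite-order twist and no parity hypothesis. [cite: Greenberg1987, §2] [cite: Weil1956, §1–§2]
[cite: Washington1997, §13.1] -/
theorem exists_lambda_pow_of_character (ι : PadicAlgCl p ≃+* ℂ) (κ : ZpExtension K p)
    (hK : Module.finrank ℚ K = 2) (himag : ∀ w : InfinitePlace K, w.IsComplex)
    (hκ : κ.IsAnticyclotomic) {σc : K ≃ₐ[ℚ] K} (hσc : σc ≠ 1)
    {Ψ : HeckeCharacter K} (hΨa : Ψ.IsAlgebraic)
    (hΨu : ∀ v : HeightOneSpectrum (𝓞 K), ((p : ℕ) : 𝓞 K) ∉ v.asIdeal → Ψ.IsUnramifiedAt v)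
    (hunit : (Ψ * (HeckeCharacter.galConj σc Ψ)⁻¹).IsUnitary)
    (htype : (Ψ * (HeckeCharacter.galConj σc Ψ)⁻¹).HasInfinityType
      (fun _ ↦ (1 : ℤ)) (fun _ ↦ (-1 : ℤ))) :
    ∃ (m : ℕ) (lam : HeckeCharacter K) (rlam : FramedGaloisRep K (PadicAlgCl p) 1), 0 < m ∧
      lam.IsUnitary ∧ lam.HasInfinityType (fun _ ↦ (m : ℤ)) (fun _ ↦ -(m : ℤ)) ∧
      (∀ x : ideleGroup ℚ, lam (AdeleRing.ideleBaseChange ℚ K x) = 1) ∧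
      (∀ v : HeightOneSpectrum (𝓞 K), ((p : ℕ) : 𝓞 K) ∉ v.asIdeal → lam.IsUnramifiedAt v) ∧
      IsPAdicAvatarOf ι lam rlam ∧ FactorsThroughZp κ rlam := by
  classical
  haveI : Algebra.IsQuadraticExtension ℚ K := { finrank_eq_two' := hK }
  haveI : IsGalois ℚ K := inferInstance
  -- the currency `e : ℚ̄_pˣ ≃ GL₁(ℚ̄_p)`
  set e := (FramedRep.unitsContinuousMulEquivOfUnique (Fin 1) (PadicAlgCl p) :
    (PadicAlgCl p)ˣ →ₜ* GL (Fin 1) (PadicAlgCl p)) with he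
  -- Step 1: `c`, its lift `θ`, and the rank-two basis (x11b3)
  obtain ⟨c, hc, hc2⟩ := exists_not_mem_range_absGaloisRestrict (L := K) (Rat.castHom ℝ) himag
  have hinj := absGaloisRestrict_injective ℚ K
  have hidx : ∀ ρ ρ' : absoluteGaloisGroup ℚ, ρ ∉ Set.range (absGaloisRestrict ℚ K) →
      ρ' ∉ Set.range (absGaloisRestrict ℚ K) → ρ⁻¹ * ρ' ∈ Set.range (absGaloisRestrict ℚ K) :=
    fun ρ ρ' hρ hρ' => inv_mul_mem_range_absGaloisRestrict hK hρ hρ'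
  obtain ⟨θ, hθ⟩ := ZpExtension.IndexTwo.exists_conjHom (absGaloisRestrict ℚ K) hinj hidx c
  have hθθ : ∀ σ, θ (θ σ) = σ := ZpExtension.IndexTwo.conjHom_conjHom hinj hc2 hθ
  obtain ⟨Φ₀, Φ₁, hsurj, hspan⟩ := exists_spanningPair (p := p) hK himag
  -- Step 2: Weil's character of `Ψ` with values in a finite `E/ℚ_p` (x11b3)
  obtain ⟨E, hEfd, a, ha, haΨ⟩ := exists_weilValued ι hΨa
  haveI : CompleteSpace E := FiniteDimensional.complete ℚ_[p] E
  set ιE : (E)ˣ →* (PadicAlgCl p)ˣ :=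
    Units.map ((algebraMap E (PadicAlgCl p) : E →+* PadicAlgCl p) : E →* PadicAlgCl p) with hιE
  -- its currency `ψa` and the avatar `e ∘ ψa⁻¹` of `Ψ`
  obtain ⟨ψa, hψa⟩ := exists_unitsChar_of_continuous (p := p) a ha
  have hψa' : ∀ σ, ψa σ = ιE (a σ) := fun σ => Units.ext (hψa σ)
  have hΨav : IsPAdicAvatarOf ι Ψ (e.comp ψa⁻¹) := by
    rw [isPAdicAvatarOf_unitsChar_iff]
    intro v hv hu
    obtain ⟨h1, h2⟩ := haΨ v hv hu
    refine ⟨fun 𝔓 h𝔓 σ hσ => ?_, fun 𝔓 h𝔓 Φ hΦ => ?_⟩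
    · rw [unitsChar_inv_apply, hψa', h1 𝔓 h𝔓 σ hσ, map_one, inv_one]
    · rw [unitsChar_inv_apply, Units.val_inv_eq_inv_val, hψa, h2 𝔓 h𝔓 Φ hΦ]
  -- Step 3: `h = a·(a∘θ)⁻¹` has finite order `M` on `N = ker Φ₀ ∩ ker Φ₁` (every `p`)
  set h : absoluteGaloisGroup K →* (E)ˣ := a * (a.comp θ.toMonoidHom)⁻¹ with hh
  have hh_apply : ∀ σ, h σ = a σ * (a (θ σ))⁻¹ := fun σ => rfl
  have hh_c : Continuous h := by
    show Continuous fun σ => h σ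
    simp only [hh_apply]
    exact ha.mul (ha.comp θ.continuous).inv
  have hh_anti : ∀ σ, h (θ σ) = (h σ)⁻¹ := fun σ => by
    rw [hh_apply, hh_apply, hθθ, mul_inv_rev, inv_inv]
  obtain ⟨M, hM, hMN⟩ := pow_eq_one_of_forall_character (p := p) (F := E) Φ₀ Φ₁ hspan h hh_c
  -- Step 4 (the squaring): `h^M` is anti-invariant and kills `N`, so `h^{2M}` kills `ker κ`
  set hM' : absoluteGaloisGroup K →* (E)ˣ := (powMonoidHom M).comp h with hhM'
  have hhM'_apply : ∀ σ, hM' σ = (h σ) ^ M := fun σ => rfl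
  have hsq : ∀ σ, κ σ = 1 → (h σ) ^ (2 * M) = 1 := fun σ hσ => by
    have h2 := mul_self_eq_one_of_anti hK κ hκ hc hc2 hθ hsurj hspan hM'
      (fun τ h0 h1 => by rw [hhM'_apply]; exact hMN τ h0 h1)
      (fun τ => by rw [hhM'_apply, hhM'_apply, hh_anti, inv_pow]) hσ
    rw [hhM'_apply] at h2
    rw [pow_mul', sq]
    exact h2
  -- Step 5: `Ψ' = Ψ^{2M}`, its avatar `e ∘ ψ'`, `ψ' = (ψa⁻¹)^{2M}`
  set k : ℕ := 2 * M with hk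
  have hkpos : 0 < k := Nat.mul_pos two_pos hM
  set Ψ' : HeckeCharacter K := Ψ ^ k with hΨ'
  set ψ' : absoluteGaloisGroup K →ₜ* (PadicAlgCl p)ˣ := ψa⁻¹ ^ k with hψ'def
  have hψ'_apply : ∀ τ, ψ' τ = ((ψa τ)⁻¹) ^ k := fun τ => by
    rw [hψ'def, ContinuousMonoidHom.pow_apply, unitsChar_inv_apply]
  have hΨ'u : ∀ v : HeightOneSpectrum (𝓞 K), ((p : ℕ) : 𝓞 K) ∉ v.asIdeal →
      Ψ'.IsUnramifiedAt v := fun v hv => isUnramifiedAt_pow' (hΨu v hv) k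
  have hΨ'av : IsPAdicAvatarOf ι Ψ' (e.comp ψ') := isPAdicAvatarOf_pow ι hΨav hΨu k
  have heq : Ψ' * (HeckeCharacter.galConj σc Ψ')⁻¹ = (Ψ * (HeckeCharacter.galConj σc Ψ)⁻¹) ^ k := by
    rw [hΨ', galConj_pow, mul_pow, inv_pow]
  -- Step 6: `λ := Ψ′ (Ψ′ ∘ σ_c)⁻¹`, `r_λ := e ∘ (ψ′ (ψ′∘θ)⁻¹)`
  refine ⟨k, Ψ' * (HeckeCharacter.galConj σc Ψ')⁻¹, e.comp (ψ' * (ψ'.comp θ)⁻¹), hkpos, ?_, ?_,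
    fun x => mul_galConj_inv_ideleBaseChange σc Ψ' x,
    fun v hv => isUnramifiedAt_mul_galConj_inv_of_forall (p := p) σc hΨ'u v hv,
    isPAdicAvatarOf_mul_galConj_inv_of_finrank_eq_two hK ι hΨ'av hΨ'u hc hθ hσc, ?_⟩
  · rw [heq]
    -- unitary characters form a submonoid
    have hupow : ∀ n : ℕ, ((Ψ * (HeckeCharacter.galConj σc Ψ)⁻¹) ^ n).IsUnitary := fun n => by
      induction n with
      | zero => rw [pow_zero]; exact HeckeCharacter.isUnitary_one
      | succ n ih => rw [pow_succ]; exact ih.mul hunit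
    exact hupow k
  · rw [heq]
    have ht := HasInfinityType.pow_nat htype k
    simpa only [mul_one, mul_neg] using ht
  -- factorisation through `κ`: on `ker κ`, `ψ′ σ · ψ′(θσ)⁻¹ = ι_E (h σ ^ {2M})⁻¹ = 1`
  · rw [factorsThroughZp_unitsChar_iff]
    intro σ hσ
    have hval : ψ' σ * (ψ' (θ σ))⁻¹ = ιE ((h σ) ^ k)⁻¹ := by
      rw [hψ'_apply, hψ'_apply, hψa', hψa', hh_apply, ← map_inv ιE, ← map_pow ιE, ← map_inv ιE,
        ← map_pow ιE, ← map_inv ιE, ← map_mul ιE]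
      congr 1
      rw [mul_pow, inv_pow, inv_pow, inv_inv, mul_inv_rev, inv_inv, mul_comm]
    rw [ContinuousMonoidHom.mul_apply, unitsChar_inv_apply, ContinuousMonoidHom.coe_comp,
      Function.comp_apply, hval, hsq σ hσ, inv_one, map_one]

/-- **The λ-SUPPLY of some positive infinity type, at EVERY prime `p`, UNCONDITIONAL**: for every
`ι' : ℚ̄_p ≃ ℂ`, every imaginary quadratic field `K` and every ANTICYCLOTOMIC `ℤ_p`-extension `κ` of
`K` there are `m > 0` and a pair `(λ, r_λ)` — `λ` a unitary Hecke character of `K` of infinity type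
`(m,−m)`, trivial on `𝕀_ℚ`, unramified outside `p`, `r_λ` its `p`-adic avatar — with `r_λ`
factoring through `κ`. At odd `p` the tree's `X11b.lambdaSupplyAt` gives `m = 1`; the point here is
`p = 2`. Proof: `exists_lambda_pow_of_character` fed with x11b3's part (A) character
(`exists_character_quotient_type_one`, `2 ≤ p`) for `σ_c` = complex conjugation.
[cite: Greenberg1987, §2] [cite: Weil1956, §1–§2] [cite: Washington1997, §13.1] -/
theorem lambdaSupplyPowAt (ι' : PadicAlgCl p ≃+* ℂ) (K : Type) [Field K] [NumberField K]
    (κ : ZpExtension K p) (hK : IsImaginaryQuadratic K) (hκ : κ.IsAnticyclotomic) :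
    ∃ (m : ℕ) (lam : HeckeCharacter K) (rlam : FramedGaloisRep K (PadicAlgCl p) 1), 0 < m ∧
      lam.IsUnitary ∧ lam.HasInfinityType (fun _ ↦ (m : ℤ)) (fun _ ↦ -(m : ℤ)) ∧
      (∀ x : ideleGroup ℚ, lam (AdeleRing.ideleBaseChange ℚ K x) = 1) ∧
      (∀ v : HeightOneSpectrum (𝓞 K), ((p : ℕ) : 𝓞 K) ∉ v.asIdeal → lam.IsUnramifiedAt v) ∧
      IsPAdicAvatarOf ι' lam rlam ∧ FactorsThroughZp κ rlam := by
  haveI : IsTotallyComplex K := hK.2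
  haveI : Algebra.IsQuadraticExtension ℚ K := { finrank_eq_two' := hK.1 }
  haveI : IsCMField K := IsCMField.ofCMExtension ℚ K
  obtain ⟨Ψ, hΨa, hΨu, hunit, htype⟩ :=
    exists_character_quotient_type_one (K := K) hK.1 (p := p) (Fact.out : p.Prime).two_le
  exact exists_lambda_pow_of_character ι' κ hK.1 IsTotallyComplex.isComplex hκ
    restrictScalars_complexConj_ne_one hΨa hΨu hunit htype

end Core

end Summit.BirchSwinnertonDyer.BirchSwinnertonDyer.Theorems.CongruentShaFreeCutLambdaSupplyAllPrimes

end
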